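import Literature.Probability.RandomPlanarGeometry.RestrictionHulls
import Literature.Topology.PlaneTopology.HalfPlaneArc
import Literature.Analysis.Complex.SimplyConnectedOfCompl
import Literature.Analysis.Complex.ArcInversion
import HarnessLib

/-!
# A Jordan arc hanging from a real point is a `*`-hull

If `Λ ≅ [0,1]` is a Jordan arc with initial point on the real axis, all other points in the open
upper half-plane, and `0 ∉ Λ`, then `Λ ∈ 𝒬*` (`IsStarHull Λ`, `isStarHull_of_arc`): it is compact,
it is the closure of `Λ ∩ ℍ = Λ ∖ {e 0}`, and `ℍ ∖ Λ` is simply connected — it is open and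
connected (`isConnected_upperHalfPlaneSet_diff_arc`, `HalfPlaneArc`) and its complement
`Λ ∪ {im ≤ 0}` is connected and unbounded (Conway's criterion `isSimplyConnected_of_compl`).
These are the hulls `g_t(η ∪ β[0, x]) - W_t` of the multi-scale argument for [LSW] Lemma 6.3
(slid simple arcs through the smooth hull).
-/

noncomputable section

open Set Filter Metric Topology Function Complex Bornology
open UpperHalfPlane (upperHalfPlaneSet isOpen_upperHalfPlaneSet)
open Literature.Topology.PlaneTopology Literature.Analysis.Complex
open scoped unitInterval

namespace Literature.Probability.RandomPlanarGeometry

/-- **A Jordan arc hanging from a real point into `ℍ`, missing `0`, is a `*`-hull.**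
[folklore] -/
theorem isStarHull_of_arc {Λ : Set ℂ} (e : I ≃ₜ Λ) (h0 : ((e 0 : Λ) : ℂ).im = 0)
    (hpos : ∀ s : I, s ≠ 0 → 0 < ((e s : Λ) : ℂ).im) (hzero : (0 : ℂ) ∉ Λ) : IsStarHull Λ := by
  set a : ℂ := ((e 0 : Λ) : ℂ) with hadef
  have hΛc : IsCompact Λ := isCompact_arc e
  have hmem : ∀ z ∈ Λ, z ≠ a → 0 < z.im := fun z hz hza ↦ by
    have h1 : e.symm ⟨z, hz⟩ ≠ 0 := fun h ↦ hza (by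
      have := congrArg (fun s ↦ ((e s : Λ) : ℂ)) h
      simpa using this)
    have := hpos _ h1
    simpa using this
  have him_nonneg : ∀ z ∈ Λ, 0 ≤ z.im := fun z hz ↦ by
    by_cases hza : z = a
    · rw [hza, h0]
    · exact (hmem z hz hza).le
  -- `Λ ∩ ℍ = Λ ∖ {a}`
  have hinter : Λ ∩ upperHalfPlaneSet = Λ \ {a} := by
    ext z
    constructor
    · rintro ⟨hz, hzH⟩
      refine ⟨hz, fun hza ↦ ?_⟩
      rw [mem_singleton_iff] at hza
      have h1 : 0 < z.im := hzH
      rw [hza, h0] at h1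
      exact lt_irrefl _ h1
    · rintro ⟨hz, hza⟩
      exact ⟨hz, hmem z hz hza⟩
  refine ⟨⟨hΛc.isBounded, ?_, ?_⟩, hzero⟩
  · -- closure of the part in `ℍ`
    rw [hinter]
    refine Subset.antisymm (hΛc.isClosed.closure_subset_iff.2 Set.sdiff_subset) fun z hz ↦ ?_
    by_cases hza : z = a
    · rw [hza]; exact endpoint_mem_closure_diff e
    · exact subset_closure ⟨hz, hza⟩
  · -- simply connected complement in `ℍ`
    have hconn : IsConnected (upperHalfPlaneSet \ Λ) :=
      isConnected_upperHalfPlaneSet_diff_arc e h0 hpos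
    have hopen : IsOpen (upperHalfPlaneSet \ Λ) := isOpen_upperHalfPlaneSet.sdiff hΛc.isClosed
    refine isSimplyConnected_of_compl hopen hconn fun b hb hbd ↦ ?_
    -- the complement `Λ ∪ {im ≤ 0}` is connected and unbounded
    have hcompl : (upperHalfPlaneSet \ Λ)ᶜ = Λ ∪ {z : ℂ | z.im ≤ 0} := by
      ext z
      simp only [mem_compl_iff, Set.mem_sdiff, not_and, not_not, mem_union, mem_setOf_eq]
      constructor
      · intro h
        by_cases hzim : 0 < z.im
        · exact Or.inl (h hzim)
        · exact Or.inr (not_lt.1 hzim)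
      · rintro (h | h) hzH
        · exact h
        · exact absurd (show 0 < z.im from hzH) (not_lt.2 h)
    have hΛconn : IsPreconnected Λ := by
      have hr : range (fun s : I ↦ ((e s : Λ) : ℂ)) = Λ := by
        ext z; constructor
        · rintro ⟨s, rfl⟩; exact (e s).2
        · intro hz; exact ⟨e.symm ⟨z, hz⟩, by simp⟩
      rw [← hr]
      exact (isConnected_range (continuous_subtype_val.comp e.continuous)).isPreconnected
    have hLconn : IsPreconnected (Λ ∪ {z : ℂ | z.im ≤ 0}) :=
      IsPreconnected.union a (e 0).2 (show a.im ≤ 0 by rw [h0]) hΛconn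
        (convex_halfSpace_im_le 0).isPreconnected
    have hsub : (upperHalfPlaneSet \ Λ)ᶜ ⊆ connectedComponentIn (upperHalfPlaneSet \ Λ)ᶜ b := by
      rw [hcompl] at hb ⊢
      exact hLconn.subset_connectedComponentIn hb subset_rfl
    have hunb : ¬ IsBounded ((upperHalfPlaneSet \ Λ)ᶜ) := by
      rw [hcompl]
      intro hbd'
      have h1 : IsBounded {z : ℂ | z.im ≤ 0} := hbd'.subset subset_union_right
      obtain ⟨R, hR⟩ := h1.subset_closedBall 0
      set z : ℂ := -(((|R| + 1 : ℝ) : ℂ) * Complex.I) with hz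
      have hzmem : z ∈ {z : ℂ | z.im ≤ 0} := by
        show z.im ≤ 0
        rw [hz]; simp only [neg_im, mul_im, Complex.ofReal_re, Complex.I_im, mul_one, Complex.ofReal_im,
          Complex.I_re, mul_zero, add_zero, neg_nonpos]
        positivity
      have hzn : ‖z‖ = |R| + 1 := by
        rw [hz, norm_neg, norm_mul, Complex.norm_real, Complex.norm_I, mul_one, Real.norm_eq_abs,
          abs_of_pos (by positivity)]
      have := hR hzmem
      rw [mem_closedBall, dist_zero_right, hzn] at this
      linarith [le_abs_self R]
    exact hunb (hbd.subset hsub)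

end Literature.Probability.RandomPlanarGeometry
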